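import Mathlib
import Summits.Ventures.PercRepro2.MixChordOStarKey2
import Summits.Ventures.PercRepro2.MixChordOStarKey3

/-!
# The algebraic key of the `o`–ROOT STAR `D`-chord (blind cell PercRepro2, night-1 g24;
proofs/NIGHT1-G24.md §4)

**`star_key`**: `(1 − q)·Gc(p⁰)·D(p) ≤ Gc(p)·D(p⁰)` for the star's polynomials in the masses of the base
instance — `gc_monomial` twice, the generic `assembly` (MixChordOStarKey1.lean) and the twenty nonnegative
Bernstein coefficients (MixChordOStarKey2.lean, MixChordOStarKey3.lean).  Own code; standard axioms.
-/

namespace Summit.Ventures.PercRepro2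

namespace Mix

namespace OStar

section Key

variable {R : Type*} [Field R] [LinearOrder R] [IsStrictOrderedRing R]

set_option maxHeartbeats 0 in
/-- **The key inequality of the `o`–root star**: `(1 − q)·Gc(p⁰)·D(p) ≤ Gc(p)·D(p⁰)` for the star's
polynomials in the masses of the base instance — `gc_monomial` twice, the `assembly`, and the twenty
nonnegative Bernstein coefficients `coeff_kj_nonneg`. -/
theorem star_key (Zq Loq Hoq Lbq Hbq LLq LHq HLq HHq Z1 L1 B1 Z0 Lo0 Ho0 Lb0 Hb0 LL0 LH0 HL0 HH0
    W q r t q' r' t' s2 s3 s4 s10 : R)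
    (hr0 : 0 ≤ r) (ht0 : 0 ≤ t) (hr' : r' = 1 - r) (ht' : t' = 1 - t) (hr'0 : 0 ≤ r') (ht'0 : 0 ≤ t')
    (hq0 : 0 ≤ q) (hq' : q' = 1 - q) (hq'0 : 0 ≤ q')
    (hZ0n : 0 ≤ Z0) (hHo0n : 0 ≤ Ho0) (hZmLo : 0 ≤ Z0 - Lo0) (hZmHo : 0 ≤ Z0 - Ho0) (hN0 : 0 ≤ Z0 - Lo0 - Ho0)
    (hW : 0 ≤ W)
    (hZ1 : Z1 = Z0 - Ho0) (hL1 : L1 = Lb0 - HL0 + W) (hB1 : B1 = Hb0 - HH0)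
    (hZq : Zq = (1 - q) * Z0 + q * Z1) (hLoq : Loq = (1 - q) * Lo0 + q * Z1) (hHoq : Hoq = (1 - q) * Ho0)
    (hLbq : Lbq = (1 - q) * Lb0 + q * L1) (hHbq : Hbq = (1 - q) * Hb0 + q * B1)
    (hLHq : LHq = (1 - q) * LH0 + q * B1)
    (hHLq : HLq = (1 - q) * HL0) (hHHq : HHq = (1 - q) * HH0)
    (hs2 : s2 = Z0 * HH0 - Ho0 * Hb0) (hs3 : s3 = Lo0 * Hb0 - Z0 * LH0) (hs4 : s4 = Ho0 * Lb0 - Z0 * HL0)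
    (hs10 : s10 = HH0 * (Z0 - Lo0 - Ho0) - Ho0 * (Hb0 - LH0 - HH0))
    (hs2n : 0 ≤ s2) (hs3n : 0 ≤ s3) (hs4n : 0 ≤ s4) (hs10n : 0 ≤ s10) :
    (1 - q) * ((((1 - r) * (1 - t) + r * (1 - t) + (1 - r) * t) * Z0 + r * t * Z1) * (((1 - r) * (1 - t) * Z0 + r * (1 - t) * (Z0 - Lo0 - Ho0)) * (((1 - r) * (1 - t) + r * (1 - t) + (1 - r) * t) * (LL0 + HH0 - HL0 - LH0) + r * t * (L1 - B1)) + ((1 - r) * (1 - t) * (Lo0 + Ho0)) * (r * (1 - t) * (LL0 + HH0 - HL0 - LH0) + (1 - r) * t * (Lb0 - Hb0) + r * t * (L1 - B1)) - ((1 - r) * (1 - t) * Z0 + r * (1 - t) * (Z0 - Lo0 - Ho0)) * (r * (1 - t) * (LL0 + HH0 - HL0 - LH0) + (1 - r) * t * (LL0 + HL0 - LH0 - HH0) + r * t * (L1 - B1))) + (((1 - r) * (1 - t) + r * (1 - t) + (1 - r) * t) * (Hb0 - Lb0) + r * t * (B1 - L1)) * (((1 - r) * (1 - t) * Z0 + r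 * (1 - t) * (Z0 - Lo0 - Ho0)) * (((1 - r) * (1 - t) + r * (1 - t) + (1 - r) * t) * (Lo0 - Ho0) + r * t * Z1) + ((1 - r) * (1 - t) * (Lo0 + Ho0)) * (r * (1 - t) * (Lo0 - Ho0) + (1 - r) * t * Z0 + r * t * Z1) - ((1 - r) * (1 - t) * Z0 + r * (1 - t) * (Z0 - Lo0 - Ho0)) * (r * (1 - t) * (Lo0 - Ho0) + (1 - r) * t * (Lo0 + Ho0) + r * t * Z1)) + (((1 - r) * (1 - t) + r * (1 - t) + (1 - r) * t) * Z0 + r * t * Z1) * (((1 - r) * (1 - t) * (Lo0 + Ho0)) * ((1 - r) * (1 - t) * (Lb0 + Hb0) + r * (1 - t) * (Lb0 + Hb0 - LL0 - LH0 - HL0 - HH0)) - ((1 - r) * (1 - t) * Z0 + r * (1 - t) * (Z0 - Lo0 - Ho0)) * ((1 - r) * (1 - t) * (LL0 + LH0 + HL0 + HH0)))) * ((1 - r) * (1 - t) * Zq + r * (1 - t) * (Zq - Hoq - Loq)) ≤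
      ((((1 - r) * (1 - t) + r * (1 - t) + (1 - r) * t) * Zq + r * t * Z1) * (((1 - r) * (1 - t) * Zq + r * (1 - t) * (Zq - Loq - Hoq)) * (((1 - r) * (1 - t) + r * (1 - t) + (1 - r) * t) * (LLq + HHq - HLq - LHq) + r * t * (L1 - B1)) + ((1 - r) * (1 - t) * (Loq + Hoq)) * (r * (1 - t) * (LLq + HHq - HLq - LHq) + (1 - r) * t * (Lbq - Hbq) + r * t * (L1 - B1)) - ((1 - r) * (1 - t) * Zq + r * (1 - t) * (Zq - Loq - Hoq)) * (r * (1 - t) * (LLq + HHq - HLq - LHq) + (1 - r) * t * (LLq + HLq - LHq - HHq) + r * t * (L1 - B1))) + (((1 - r) * (1 - t) + r * (1 - t) + (1 - r) * t) * (Hbq - Lbq) + r * t * (B1 - L1)) * (((1 - r) * (1 - t) * Zq + r * (1 - t) * (Zq - Loq - Hoq)) * (((1 - r) * (1 - t) + r * (1 - t) + (1 - r) * t) * (Loq - Hoq) + r * t * Z1) + ((1 - r) * (1 - t) * (Loq + Hoq)) * (r * (1 - t) * (Loq - Hoq) + (1 - r) * t * Zq + r * t * Z1) - ((1 - r) * (1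 - t) * Zq + r * (1 - t) * (Zq - Loq - Hoq)) * (r * (1 - t) * (Loq - Hoq) + (1 - r) * t * (Loq + Hoq) + r * t * Z1)) + (((1 - r) * (1 - t) + r * (1 - t) + (1 - r) * t) * Zq + r * t * Z1) * (((1 - r) * (1 - t) * (Loq + Hoq)) * ((1 - r) * (1 - t) * (Lbq + Hbq) + r * (1 - t) * (Lbq + Hbq - LLq - LHq - HLq - HHq)) - ((1 - r) * (1 - t) * Zq + r * (1 - t) * (Zq - Loq - Hoq)) * ((1 - r) * (1 - t) * (LLq + LHq + HLq + HHq)))) * ((1 - r) * (1 - t) * Z0 + r * (1 - t) * (Z0 - Ho0 - Lo0)) := by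
  have hc1 : (0 : R) ≤ 1 := by norm_num
  have hc4 : (0 : R) ≤ 4 := by norm_num
  have hc6 : (0 : R) ≤ 6 := by norm_num
  have hc16 : (0 : R) ≤ 16 := by norm_num
  have hc24 : (0 : R) ≤ 24 := by norm_num
  have hc36 : (0 : R) ≤ 36 := by norm_num
  rw [← sub_nonneg, gc_monomial Zq Loq Hoq Lbq Hbq LLq LHq HLq HHq Z1 L1 B1 r t,
    gc_monomial Z0 Lo0 Ho0 Lb0 Hb0 LL0 LH0 HL0 HH0 Z1 L1 B1 r t,
    assembly _ _ _ _ _ _ _ _ _ _ _ _ _ _ _ _ _ _ _ _ _ _ _ _ _ _ _ _ _ _ _ _ Zq Loq Hoq Z0 Lo0 Ho0 q r t r' t' hr' ht']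
  exact (add_nonneg (add_nonneg (add_nonneg (add_nonneg (add_nonneg (add_nonneg (add_nonneg (add_nonneg (add_nonneg (add_nonneg (add_nonneg (add_nonneg (add_nonneg (add_nonneg (add_nonneg (add_nonneg (mul_nonneg (mul_nonneg (mul_nonneg (mul_nonneg (mul_nonneg (mul_nonneg (mul_nonneg (mul_nonneg (mul_nonneg hc1 ht'0) ht'0) ht'0) ht'0) hr'0) hr'0) hr'0) hr'0) (coeff_00_nonneg rfl rfl hZq hLoq hHoq hLbq hHbq hLHq hHLq hZ1 hL1 hB1 hs10 hq' hq0 hq'0 hHo0n hZ0n hZmHo hW hs10n)) (mul_nonneg (mul_nonneg (mul_nonneg (mul_nonneg (mul_nonneg (mul_nonneg (mul_nonneg (mul_nonneg (mul_nonneg hc4 ht'0) ht'0) ht'0) ht'0) hr0) hr'0) hr'0) hr'0) (coeff_01_nonneg rfl rfl rfl rfl hZq hLoq hHoq hLbq hHbq hLHq hHLq hZ1 hL1 hB1 hs3 hs4 hs10 hq' hq0 hq'0 hHo0n hZmLo hZ0n hZmHo hN0 hW hs3n hs4n hs10n))) (mul_nonneg (mul_nonneg (mul_nonneg (mul_nonneg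 (mul_nonneg (mul_nonneg (mul_nonneg (mul_nonneg (mul_nonneg hc6 ht'0) ht'0) ht'0) ht'0) hr0) hr0) hr'0) hr'0) (coeff_02_nonneg rfl rfl rfl rfl rfl rfl hZq hLoq hHoq hLbq hHbq hLHq hHLq hZ1 hL1 hB1 hs3 hs4 hs10 hq' hq0 hq'0 hHo0n hZmLo hZ0n hZmHo hN0 hW hs3n hs4n hs10n))) (mul_nonneg (mul_nonneg (mul_nonneg (mul_nonneg (mul_nonneg (mul_nonneg (mul_nonneg (mul_nonneg (mul_nonneg hc4 ht'0) ht'0) ht'0) ht'0) hr0) hr0) hr0) hr'0) (coeff_03_nonneg rfl rfl rfl rfl rfl rfl rfl rfl hZq hLoq hHoq hLbq hHbq hLHq hHLq hZ1 hL1 hB1 hs3 hs4 hs10 hq' hq0 hq'0 hHo0n hZ0n hZmHo hN0 hW hs3n hs4n hs10n))) (mul_nonneg (mul_nonneg (mul_nonneg (mul_nonneg (mul_nonneg (mul_nonneg (mul_nonneg (mul_nonneg (mul_nonneg hc1 ht'0) ht'0) ht'0) ht'0) hr0) hr0) hr0) hr0) (coeff_04_nonneg rfl rfl rfl rfl rfl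 rfl rfl rfl ))) (mul_nonneg (mul_nonneg (mul_nonneg (mul_nonneg (mul_nonneg (mul_nonneg (mul_nonneg (mul_nonneg (mul_nonneg hc4 ht0) ht'0) ht'0) ht'0) hr'0) hr'0) hr'0) hr'0) (coeff_10_nonneg rfl rfl rfl rfl hZq hLoq hHoq hLbq hHbq hLHq hHLq hHHq hZ1 hL1 hB1 hs10 hq' hq0 hq'0 hHo0n hZ0n hZmHo hW hs10n))) (mul_nonneg (mul_nonneg (mul_nonneg (mul_nonneg (mul_nonneg (mul_nonneg (mul_nonneg (mul_nonneg (mul_nonneg hc16 ht0) ht'0) ht'0) ht'0) hr0) hr'0) hr'0) hr'0) (coeff_11_nonneg rfl rfl rfl rfl rfl rfl rfl rfl hZq hLoq hHoq hLbq hHbq hLHq hHLq hHHq hZ1 hL1 hB1 hs2 hs3 hs4 hs10 hq' hq0 hq'0 hHo0n hZmLo hZ0n hZmHo hN0 hW hs2n hs3n hs4n hs10n))) (mul_nonneg (mul_nonneg (mul_nonneg (mul_nonneg (mul_nonneg (mul_nonneg (mul_nonneg (mul_nonneg (mul_nonneg hc24 ht0) ht'0) ht'0) ht'0) hr0) hr0)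 hr'0) hr'0) (coeff_12_nonneg rfl rfl rfl rfl rfl rfl rfl rfl rfl rfl rfl rfl hZq hLoq hHoq hLbq hHbq hLHq hHLq hHHq hZ1 hL1 hB1 hs2 hs3 hs4 hs10 hq' hq0 hq'0 hHo0n hZ0n hZmHo hN0 hW hs2n hs3n hs4n hs10n))) (mul_nonneg (mul_nonneg (mul_nonneg (mul_nonneg (mul_nonneg (mul_nonneg (mul_nonneg (mul_nonneg (mul_nonneg hc16 ht0) ht'0) ht'0) ht'0) hr0) hr0) hr0) hr'0) (coeff_13_nonneg rfl rfl rfl rfl rfl rfl rfl rfl rfl rfl rfl rfl rfl rfl rfl rfl hZq hLoq hHoq hLbq hHbq hLHq hHLq hHHq hZ1 hL1 hB1 hs3 hs4 hs10 hq' hq0 hq'0 hHo0n hZmHo hN0 hW hs3n hs4n hs10n))) (mul_nonneg (mul_nonneg (mul_nonneg (mul_nonneg (mul_nonneg (mul_nonneg (mul_nonneg (mul_nonneg (mul_nonneg hc4 ht0) ht'0) ht'0) ht'0) hr0) hr0) hr0) hr0) (coeff_14_nonneg rfl rfl rfl rfl rfl rfl rfl rfl rfl rfl rfl rfl rfl rfl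 rfl rfl ))) (mul_nonneg (mul_nonneg (mul_nonneg (mul_nonneg (mul_nonneg (mul_nonneg (mul_nonneg (mul_nonneg (mul_nonneg hc6 ht0) ht0) ht'0) ht'0) hr'0) hr'0) hr'0) hr'0) (coeff_20_nonneg rfl rfl rfl rfl rfl rfl hZq hHoq hLbq hHbq hHLq hHHq hZ1 hL1 hB1  hq' hq0 hq'0 hHo0n hZ0n hZmHo hW))) (mul_nonneg (mul_nonneg (mul_nonneg (mul_nonneg (mul_nonneg (mul_nonneg (mul_nonneg (mul_nonneg (mul_nonneg hc24 ht0) ht0) ht'0) ht'0) hr0) hr'0) hr'0) hr'0) (coeff_21_nonneg rfl rfl rfl rfl rfl rfl rfl rfl rfl rfl rfl rfl hZq hLoq hHoq hLbq hHbq hHLq hHHq hZ1 hL1 hB1  hq' hq0 hq'0 hHo0n hZ0n hZmHo hN0 hW))) (mul_nonneg (mul_nonneg (mul_nonneg (mul_nonneg (mul_nonneg (mul_nonneg (mul_nonneg (mul_nonneg (mul_nonneg hc36 ht0) ht0) ht'0) ht'0) hr0) hr0) hr'0) hr'0) (coeff_22_nonneg rfl rfl rfl rfl rfl rfl rfl rfl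 rfl rfl rfl rfl rfl rfl rfl rfl rfl rfl hZq hLoq hHoq hLbq hHbq hHLq hHHq hZ1 hL1 hB1  hq' hq0 hq'0 hHo0n hN0 hW))) (mul_nonneg (mul_nonneg (mul_nonneg (mul_nonneg (mul_nonneg (mul_nonneg (mul_nonneg (mul_nonneg (mul_nonneg hc24 ht0) ht0) ht'0) ht'0) hr0) hr0) hr0) hr'0) (coeff_23_nonneg rfl rfl rfl rfl rfl rfl rfl rfl rfl rfl rfl rfl rfl rfl rfl rfl rfl rfl rfl rfl rfl rfl rfl rfl hZq hLoq hHoq hHLq hHHq))) (mul_nonneg (mul_nonneg (mul_nonneg (mul_nonneg (mul_nonneg (mul_nonneg (mul_nonneg (mul_nonneg (mul_nonneg hc6 ht0) ht0) ht'0) ht'0) hr0) hr0) hr0) hr0) (coeff_24_nonneg rfl rfl rfl rfl rfl rfl rfl rfl rfl rfl rfl rfl rfl rfl rfl rfl rfl rfl rfl rfl rfl rfl rfl rfl ))) (mul_nonneg (mul_nonneg (mul_nonneg (mul_nonneg (mul_nonneg (mul_nonneg (mul_nonneg (mul_nonneg (mul_nonneg hc4 ht0) ht0) ht0) ht'0)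 hr'0) hr'0) hr'0) hr'0) (coeff_30_nonneg rfl rfl rfl rfl rfl rfl rfl rfl ))) (add_nonneg (add_nonneg (add_nonneg (mul_nonneg (mul_nonneg (mul_nonneg (mul_nonneg (mul_nonneg (mul_nonneg (mul_nonneg (mul_nonneg (mul_nonneg hc16 ht0) ht0) ht0) ht'0) hr0) hr'0) hr'0) hr'0) (coeff_31_nonneg rfl rfl rfl rfl rfl rfl rfl rfl rfl rfl rfl rfl rfl rfl rfl rfl )) (mul_nonneg (mul_nonneg (mul_nonneg (mul_nonneg (mul_nonneg (mul_nonneg (mul_nonneg (mul_nonneg (mul_nonneg hc24 ht0) ht0) ht0) ht'0) hr0) hr0) hr'0) hr'0) (coeff_32_nonneg rfl rfl rfl rfl rfl rfl rfl rfl rfl rfl rfl rfl rfl rfl rfl rfl rfl rfl rfl rfl rfl rfl rfl rfl ))) (mul_nonneg (mul_nonneg (mul_nonneg (mul_nonneg (mul_nonneg (mul_nonneg (mul_nonneg (mul_nonneg (mul_nonneg hc16 ht0) ht0) ht0) ht'0) hr0) hr0) hr0) hr'0) (coeff_33_nonneg rfl rfl rfl rfl rfl rfl rfl rfl rfl rfl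 rfl rfl rfl rfl rfl rfl rfl rfl rfl rfl rfl rfl rfl rfl rfl rfl rfl rfl rfl rfl rfl rfl ))) (mul_nonneg (mul_nonneg (mul_nonneg (mul_nonneg (mul_nonneg (mul_nonneg (mul_nonneg (mul_nonneg (mul_nonneg hc4 ht0) ht0) ht0) ht'0) hr0) hr0) hr0) hr0) (coeff_34_nonneg rfl rfl rfl rfl rfl rfl rfl rfl rfl rfl rfl rfl rfl rfl rfl rfl rfl rfl rfl rfl rfl rfl rfl rfl rfl rfl rfl rfl rfl rfl rfl rfl ))))

end Key

end OStar

end Mix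

end Summit.Ventures.PercRepro2
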